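import Mathlib
import Literature.AlgebraicGeometry.Resolution.CobordantGame
import Literature.AlgebraicGeometry.Resolution.CobordantTupleGame
import Literature.AlgebraicGeometry.Resolution.FormalCoordinateChange
import Literature.AlgebraicGeometry.Resolution.FormalInverseFunction
import Literature.AlgebraicGeometry.Resolution.CobordantArcLemma

/-!
# Helpers for the Tschirnhaus (maximal contact) form — `y`-slices of shears and Hasse derivatives

Crux `LocalWeightedDrop` (stmt-ResolutionOfSingularities-8899, route ResolutionOfSingularities/WeightedInvariant),
line `hasse-ridge-face-selection`, registered stub `stub_tschirnhausForm` (file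
`WeightedInvariantLocalWeightedDropTschirnhausForm`).  Over any field `k`, in `k[[x', y]]` with the
distinguished LAST variable `y = X (Fin.last m)` and `x' = (X (Fin.castSucc j))_j`:

* `y`-FREE series (`coeff E g = 0` whenever `E y ≠ 0`) are closed under products and powers, and the
  `y^q`-slice of `g · y^r` (`g` `y`-free) is `g` if `r = q` and `0` otherwise (`coeff_add_single_mul_X_pow`);
  the BINOMIAL SLICE `coeff (β + q e_y) (g · (y + φ)^n) = C(n, q) · coeff β (g · φ^{n-q})` for `y`-free
  `g, φ` (`coeff_add_single_mul_add_pow`).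
* HASSE SLICE (`coeff_shear_slice`; registered sub-goal `stub_tschirnhausHasseSlice` at the end of the file):
  for the shear `τ = (x', y + φ)` by a `y`-free `φ ∈ 𝔪` and the
  `q`-th Hasse derivative `P = ∂_y^{(q)} F` (`coeff E P = C(E_y + q, q) · coeff (E + q e_y) F`), the
  `y^q`-slice of `F ∘ τ` is `P(x', φ)`: `coeff (β + q e_y) (F ∘ τ) = coeff β (P ∘ (x', φ))` — both sides
  are the same finite sum after the shift `E ↦ E + q e_y` (`finsum_shift`).
* DIAGONAL RESTRICTION (`coeff_single_subst_smul_X`): the `y^d` coefficient of `F(v₀ y, …, v_m y)` is the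
  value at `v` of the degree-`d` form of `F`, a finite sum over `Finset.finsuppAntidiag`.
* Bookkeeping: determinants of matrices all of whose rows but the last are identity rows
  (`det_of_offLast_rows`), and the splitting `E = x'^β · y^n` of exponents (`exists_eq_emb_add_single`, …).
-/

set_option linter.dupNamespace false -- mandated namespace of this single-conjunct summit

namespace Summit.ResolutionOfSingularities.ResolutionOfSingularities.Theorems

open Literature.AlgebraicGeometry.Resolution

namespace TschirnhausForm

open MvPowerSeries

variable {k : Type} [Field k] {m : ℕ}

/-! ### Monomials in a family split off the last factor -/

/-- `∏_i g_i^{E_i} = (∏_{j<m} g_j^{E_j}) · g_y^{E_y}`. -/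
theorem finsuppProd_pow_eq {τ : Type} [CommSemiring τ] (g : Fin (m + 1) → τ) (E : Fin (m + 1) →₀ ℕ) :
    (E.prod fun i n => g i ^ n) =
      (∏ j : Fin m, g (Fin.castSucc j) ^ E (Fin.castSucc j)) * g (Fin.last m) ^ E (Fin.last m) := by
  rw [Finsupp.prod_fintype _ _ (fun i => pow_zero _), Fin.prod_univ_castSucc]

/-! ### `y`-free series -/

/-- Products of `y`-free series are `y`-free. -/
theorem noY_mul {g h : MvPowerSeries (Fin (m + 1)) k}
    (hg : ∀ E : Fin (m + 1) →₀ ℕ, E (Fin.last m) ≠ 0 → coeff E g = 0)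
    (hh : ∀ E : Fin (m + 1) →₀ ℕ, E (Fin.last m) ≠ 0 → coeff E h = 0) :
    ∀ E : Fin (m + 1) →₀ ℕ, E (Fin.last m) ≠ 0 → coeff E (g * h) = 0 := by
  intro E hE
  rw [coeff_mul]
  refine Finset.sum_eq_zero fun p hp => ?_
  rw [Finset.HasAntidiagonal.mem_antidiagonal] at hp
  have hsum : p.1 (Fin.last m) + p.2 (Fin.last m) = E (Fin.last m) := by
    rw [← hp, Finsupp.add_apply]
  by_cases h1 : p.1 (Fin.last m) = 0
  · rw [hh p.2 (by omega), mul_zero]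
  · rw [hg p.1 h1, zero_mul]

/-- `1` is `y`-free. -/
theorem noY_one :
    ∀ E : Fin (m + 1) →₀ ℕ, E (Fin.last m) ≠ 0 → coeff E (1 : MvPowerSeries (Fin (m + 1)) k) = 0 := by
  classical
  intro E hE
  rw [coeff_one, if_neg]
  rintro rfl
  exact hE rfl

/-- Powers of `y`-free series are `y`-free. -/
theorem noY_pow {g : MvPowerSeries (Fin (m + 1)) k}
    (hg : ∀ E : Fin (m + 1) →₀ ℕ, E (Fin.last m) ≠ 0 → coeff E g = 0) (n : ℕ) :
    ∀ E : Fin (m + 1) →₀ ℕ, E (Fin.last m) ≠ 0 → coeff E (g ^ n) = 0 := by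
  induction n with
  | zero => rw [pow_zero]; exact noY_one
  | succ n ih => rw [pow_succ]; exact noY_mul ih hg

/-- The variables `x_j = X (Fin.castSucc j)` are `y`-free. -/
theorem noY_X_castSucc (j : Fin m) : ∀ E : Fin (m + 1) →₀ ℕ, E (Fin.last m) ≠ 0 →
    coeff E (X (Fin.castSucc j) : MvPowerSeries (Fin (m + 1)) k) = 0 := by
  classical
  intro E hE
  rw [coeff_X, if_neg]
  rintro rfl
  exact hE (Finsupp.single_eq_of_ne (Fin.castSucc_lt_last j).ne')

/-- Monomials in `x'` are `y`-free. -/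
theorem noY_prodX (E : Fin (m + 1) →₀ ℕ) : ∀ E' : Fin (m + 1) →₀ ℕ, E' (Fin.last m) ≠ 0 →
    coeff E' (∏ j : Fin m, (X (Fin.castSucc j) : MvPowerSeries (Fin (m + 1)) k) ^ E (Fin.castSucc j)) = 0 :=
  Finset.prod_induction _ (fun g => ∀ E' : Fin (m + 1) →₀ ℕ, E' (Fin.last m) ≠ 0 → coeff E' g = 0)
    (fun _ _ ha hb => noY_mul ha hb) noY_one (fun j _ => noY_pow (noY_X_castSucc j) _)

/-! ### `y`-slices -/

/-- The `y^q`-slice of `g · y^r` for `y`-free `g`: `g` if `r = q`, else `0`. -/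
theorem coeff_add_single_mul_X_pow {g : MvPowerSeries (Fin (m + 1)) k}
    (hg : ∀ E : Fin (m + 1) →₀ ℕ, E (Fin.last m) ≠ 0 → coeff E g = 0)
    {β : Fin (m + 1) →₀ ℕ} (hβ : β (Fin.last m) = 0) (q r : ℕ) :
    coeff (β + Finsupp.single (Fin.last m) q) (g * X (Fin.last m) ^ r) = if r = q then coeff β g else 0 := by
  classical
  rw [X_pow_eq, coeff_mul_monomial, mul_one]
  by_cases hrq : r = q
  · subst hrq
    rw [if_pos le_add_self, add_tsub_cancel_right, if_pos rfl]
  · rw [if_neg hrq]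
    split_ifs with hle
    · apply hg
      have hrq' : r ≤ q := by
        have := Finsupp.single_le_iff.mp hle
        rwa [Finsupp.add_apply, hβ, Finsupp.single_eq_same, zero_add] at this
      rw [Finsupp.tsub_apply, Finsupp.add_apply, hβ, Finsupp.single_eq_same, Finsupp.single_eq_same, zero_add]
      omega
    · rfl

/-- BINOMIAL SLICE: the `y^q`-slice of `g · (y + φ)^n` for `y`-free `g, φ` is `C(n, q) · g · φ^{n-q}`. -/
theorem coeff_add_single_mul_add_pow {g φ : MvPowerSeries (Fin (m + 1)) k}
    (hg : ∀ E : Fin (m + 1) →₀ ℕ, E (Fin.last m) ≠ 0 → coeff E g = 0)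
    (hφ : ∀ E : Fin (m + 1) →₀ ℕ, E (Fin.last m) ≠ 0 → coeff E φ = 0)
    {β : Fin (m + 1) →₀ ℕ} (hβ : β (Fin.last m) = 0) (q n : ℕ) :
    coeff (β + Finsupp.single (Fin.last m) q) (g * (X (Fin.last m) + φ) ^ n) =
      (n.choose q : k) * coeff β (g * φ ^ (n - q)) := by
  rw [add_pow, Finset.mul_sum, map_sum]
  have hterm : ∀ r ∈ Finset.range (n + 1), coeff (β + Finsupp.single (Fin.last m) q)
      (g * (X (Fin.last m) ^ r * φ ^ (n - r) * (n.choose r : MvPowerSeries (Fin (m + 1)) k))) =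
        if r = q then (n.choose q : k) * coeff β (g * φ ^ (n - q)) else 0 := by
    intro r _
    have hre : g * (X (Fin.last m) ^ r * φ ^ (n - r) * (n.choose r : MvPowerSeries (Fin (m + 1)) k)) =
        C (n.choose r : k) * ((g * φ ^ (n - r)) * X (Fin.last m) ^ r) := by
      rw [← map_natCast (C : k →+* MvPowerSeries (Fin (m + 1)) k)]
      ring
    rw [hre, coeff_C_mul, coeff_add_single_mul_X_pow (noY_mul hg (noY_pow hφ _)) hβ]
    split_ifs with h
    · subst h
      rfl
    · rw [mul_zero]
  rw [Finset.sum_congr rfl hterm, Finset.sum_ite_eq']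
  split_ifs with h
  · rfl
  · rw [Finset.mem_range] at h
    rw [Nat.choose_eq_zero_of_lt (by omega), Nat.cast_zero, zero_mul]

/-! ### Shifting a finite sum of exponents -/

/-- A sum over exponents supported above `s` is a sum over the shifted exponents `E + s`. -/
theorem finsum_shift {M : Type} [AddCommMonoid M] (s : Fin (m + 1) →₀ ℕ) (g : (Fin (m + 1) →₀ ℕ) → M)
    (hg : ∀ E, ¬ s ≤ E → g E = 0) : ∑ᶠ E, g E = ∑ᶠ E, g (E + s) := by
  have h1 : ∑ᶠ E ∈ Set.range (fun E : Fin (m + 1) →₀ ℕ => E + s), g E = ∑ᶠ E, g (E + s) :=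
    finsum_mem_range (add_left_injective s)
  rw [← h1, ← finsum_mem_univ g]
  apply finsum_mem_inter_support_eq
  ext E
  simp only [Set.mem_inter_iff, Set.mem_univ, true_and, Set.mem_range, Function.mem_support]
  constructor
  · intro hE
    refine ⟨?_, hE⟩
    by_contra hr
    refine hE (hg E fun hle => hr ⟨E - s, tsub_add_cancel_of_le hle⟩)
  · exact And.right

/-! ### The Hasse slice of a shear -/

/-- HASSE SLICE.  For a `y`-free `φ ∈ 𝔪`, the shear `τ = (x', y + φ)`, the restriction `ρ = (x', φ)` and the
`q`-th Hasse derivative `P = ∂_y^{(q)} F` (coefficientwise `coeff E P = C(E_y + q, q) · coeff (E + q e_y) F`):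
the `y^q`-slice of `F ∘ τ` is `P ∘ ρ`. -/
theorem coeff_shear_slice {φ : MvPowerSeries (Fin (m + 1)) k}
    (hφ : ∀ E : Fin (m + 1) →₀ ℕ, E (Fin.last m) ≠ 0 → coeff E φ = 0) (hφ0 : constantCoeff φ = 0)
    {τ ρ : Fin (m + 1) → MvPowerSeries (Fin (m + 1)) k}
    (hτ : ∀ i, τ i = if i = Fin.last m then X (Fin.last m) + φ else X i)
    (hρ : ∀ i, ρ i = if i = Fin.last m then φ else X i) (q : ℕ) {F P : MvPowerSeries (Fin (m + 1)) k}
    (hP : ∀ E : Fin (m + 1) →₀ ℕ, coeff E P =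
      ((E (Fin.last m) + q).choose q : k) * coeff (E + Finsupp.single (Fin.last m) q) F)
    {β : Fin (m + 1) →₀ ℕ} (hβ : β (Fin.last m) = 0) :
    coeff (β + Finsupp.single (Fin.last m) q) (subst τ F) = coeff β (subst ρ P) := by
  have hτ0 : ∀ i, constantCoeff (τ i) = 0 := fun i => by
    rw [hτ]; split_ifs <;> simp [constantCoeff_X, hφ0]
  have hρ0 : ∀ i, constantCoeff (ρ i) = 0 := fun i => by
    rw [hρ]; split_ifs <;> simp [constantCoeff_X, hφ0]
  set Px : (Fin (m + 1) →₀ ℕ) → MvPowerSeries (Fin (m + 1)) k :=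
    fun E => ∏ j : Fin m, X (Fin.castSucc j) ^ E (Fin.castSucc j) with hPx
  have hτprod : ∀ E : Fin (m + 1) →₀ ℕ,
      (E.prod fun i n => τ i ^ n) = Px E * (X (Fin.last m) + φ) ^ E (Fin.last m) := by
    intro E
    rw [finsuppProd_pow_eq]
    congr 1
    · exact Finset.prod_congr rfl fun j _ => by rw [hτ, if_neg (Fin.castSucc_lt_last j).ne]
    · rw [hτ, if_pos rfl]
  have hρprod : ∀ E : Fin (m + 1) →₀ ℕ, (E.prod fun i n => ρ i ^ n) = Px E * φ ^ E (Fin.last m) := by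
    intro E
    rw [finsuppProd_pow_eq]
    congr 1
    · exact Finset.prod_congr rfl fun j _ => by rw [hρ, if_neg (Fin.castSucc_lt_last j).ne]
    · rw [hρ, if_pos rfl]
  set g : (Fin (m + 1) →₀ ℕ) → k := fun E =>
    coeff E F * (((E (Fin.last m)).choose q : k) * coeff β (Px E * φ ^ (E (Fin.last m) - q))) with hg
  rw [coeff_subst (hasSubst_of_constantCoeff_zero hτ0), coeff_subst (hasSubst_of_constantCoeff_zero hρ0)]
  calc ∑ᶠ E, coeff E F • coeff (β + Finsupp.single (Fin.last m) q) (E.prod fun i n => τ i ^ n)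
      = ∑ᶠ E, g E := by
        refine finsum_congr fun E => ?_
        rw [hτprod, coeff_add_single_mul_add_pow (noY_prodX E) hφ hβ, smul_eq_mul]
    _ = ∑ᶠ E, g (E + Finsupp.single (Fin.last m) q) := by
        refine finsum_shift _ g fun E hE => ?_
        have hlt : E (Fin.last m) < q := by rwa [Finsupp.single_le_iff, not_le] at hE
        simp only [hg, Nat.choose_eq_zero_of_lt hlt, Nat.cast_zero, zero_mul, mul_zero]
    _ = ∑ᶠ E, coeff E P • coeff β (E.prod fun i n => ρ i ^ n) := by
        refine finsum_congr fun E => ?_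
        have hPx : Px (E + Finsupp.single (Fin.last m) q) = Px E := Finset.prod_congr rfl fun j _ => by
          rw [Finsupp.add_apply, Finsupp.single_eq_of_ne (Fin.castSucc_lt_last j).ne, add_zero]
        rw [hρprod, hP, smul_eq_mul, hg]
        simp only [Finsupp.add_apply, Finsupp.single_eq_same, Nat.add_sub_cancel, hPx]
        ring

/-! ### The diagonal restriction `x_i ↦ v_i · y` -/

/-- DIAGONAL RESTRICTION: the `y^d`-coefficient of `G(v₀ y, …, v_{N-1} y)` (`y = X l`) is the value at `v` of
the degree-`d` form of `G`. -/
theorem coeff_single_subst_smul_X {N : ℕ} (v : Fin N → k) (l : Fin N) (d : ℕ) (G : MvPowerSeries (Fin N) k) :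
    coeff (Finsupp.single l d) (subst (fun i => v i • (X l : MvPowerSeries (Fin N) k)) G) =
      ∑ α ∈ (Finset.univ : Finset (Fin N)).finsuppAntidiag d, coeff α G * α.prod fun i n => v i ^ n := by
  classical
  have h0 : ∀ i, constantCoeff (v i • (X l : MvPowerSeries (Fin N) k)) = 0 := fun i => by
    rw [smul_eq_C_mul, map_mul, constantCoeff_X, mul_zero]
  have hprod : ∀ α : Fin N →₀ ℕ, (α.prod fun i n => (v i • (X l : MvPowerSeries (Fin N) k)) ^ n) =
      C (α.prod fun i n => v i ^ n) * X l ^ α.degree := by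
    intro α
    have hfun : (fun i n => (v i • (X l : MvPowerSeries (Fin N) k)) ^ n) =
        fun i n => C (v i ^ n) * X l ^ n := by
      funext i n
      rw [smul_eq_C_mul, mul_pow, map_pow]
    have hC : (α.prod fun i n => C (v i ^ n) : MvPowerSeries (Fin N) k) = C (α.prod fun i n => v i ^ n) :=
      (map_finsuppProd C α (fun i n => v i ^ n)).symm
    have hX : (α.prod fun _ n => (X l : MvPowerSeries (Fin N) k) ^ n) = X l ^ α.degree := by
      rw [Finsupp.prod, Finset.prod_pow_eq_pow_sum, Finsupp.degree_apply]
    rw [hfun, Finsupp.prod_mul, hC, hX]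
  rw [coeff_subst (hasSubst_of_constantCoeff_zero h0)]
  simp_rw [hprod, coeff_C_mul, coeff_X_pow]
  rw [finsum_eq_sum_of_support_subset (s := (Finset.univ : Finset (Fin N)).finsuppAntidiag d)]
  · refine Finset.sum_congr rfl fun α hα => ?_
    rw [Finset.mem_finsuppAntidiag] at hα
    have hdeg : α.degree = d := by rw [Finsupp.degree_eq_sum]; exact hα.1
    rw [hdeg, if_pos rfl, mul_one, smul_eq_mul]
  · intro α hα
    rw [Function.mem_support] at hα
    rw [Finset.mem_coe, Finset.mem_finsuppAntidiag]
    refine ⟨?_, Finset.subset_univ _⟩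
    rw [← Finsupp.degree_eq_sum]
    by_contra hne
    exact hα (by rw [if_neg (fun h => hne ((Finsupp.single_injective l) h).symm), mul_zero, smul_zero])

/-! ### Linear parts -/

/-- A matrix all of whose rows but the last are identity rows has determinant its last diagonal entry. -/
theorem det_of_offLast_rows (R : Matrix (Fin (m + 1)) (Fin (m + 1)) k)
    (hR : ∀ i j, i ≠ Fin.last m → R i j = if j = i then 1 else 0) : R.det = R (Fin.last m) (Fin.last m) := by
  rw [Matrix.det_of_lowerTriangular R]
  · exact Fintype.prod_eq_single (Fin.last m) fun i hi => by rw [hR i i hi, if_pos rfl]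
  · intro i j hij
    have hij' : i < j := OrderDual.toDual_lt_toDual.mp hij
    rw [hR i j (ne_of_lt (lt_of_lt_of_le hij' (Fin.le_last j))), if_neg (ne_of_gt hij')]

/-- FIRST-ORDER CHAIN RULE in matrix form: linear parts multiply under composition of substitutions. -/
theorem linMat_subst {n : ℕ} (a : Fin n → MvPowerSeries (Fin n) k) (ha : ∀ i, constantCoeff (a i) = 0)
    (L : Fin n → MvPowerSeries (Fin n) k) :
    (Matrix.of fun i j => coeff (Finsupp.single j 1) (subst a (L i))) =
      (Matrix.of fun i l => coeff (Finsupp.single l 1) (L i)) *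
        Matrix.of fun l j => coeff (Finsupp.single j 1) (a l) := by
  ext i j
  rw [Matrix.mul_apply, Matrix.of_apply, CobordantArc.coeff_degree_one_subst a ha (L i) _ (Finsupp.degree_single _ _)]
  rfl

/-! ### Exponents `x'^β y^n`: the embedding of the first `m` variables and the last slot -/

/-- The embedded exponent vanishes at the last slot. -/
theorem embDomain_last (β : Fin m →₀ ℕ) :
    Finsupp.embDomain (Fin.succAboveEmb (Fin.last m)) β (Fin.last m) = 0 :=
  Finsupp.embDomain_notin_range _ _ _ (by simp)

/-- The embedded exponent at `x_j`. -/
theorem embDomain_castSucc (β : Fin m →₀ ℕ) (j : Fin m) :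
    Finsupp.embDomain (Fin.succAboveEmb (Fin.last m)) β (Fin.castSucc j) = β j := by
  rw [← Fin.succAbove_last_apply, ← Fin.coe_succAboveEmb, Finsupp.embDomain_apply_self]

/-- `x'^β y^n` at the last slot. -/
theorem emb_add_single_last (β : Fin m →₀ ℕ) (n : ℕ) :
    (Finsupp.embDomain (Fin.succAboveEmb (Fin.last m)) β + Finsupp.single (Fin.last m) n) (Fin.last m) = n := by
  rw [Finsupp.add_apply, embDomain_last, Finsupp.single_eq_same, zero_add]

/-- `x'^β y^n` at the slot `x_j`. -/
theorem emb_add_single_castSucc (β : Fin m →₀ ℕ) (n : ℕ) (j : Fin m) :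
    (Finsupp.embDomain (Fin.succAboveEmb (Fin.last m)) β + Finsupp.single (Fin.last m) n) (Fin.castSucc j) = β j := by
  rw [Finsupp.add_apply, embDomain_castSucc, Finsupp.single_eq_of_ne (Fin.castSucc_lt_last j).ne, add_zero]

/-- Every exponent is `x'^β y^n` with `n` its last entry. -/
theorem exists_eq_emb_add_single (E : Fin (m + 1) →₀ ℕ) : ∃ β : Fin m →₀ ℕ,
    E = Finsupp.embDomain (Fin.succAboveEmb (Fin.last m)) β + Finsupp.single (Fin.last m) (E (Fin.last m)) := by
  refine ⟨Finsupp.equivFunOnFinite.symm fun j => E (Fin.castSucc j), ?_⟩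
  ext i
  rcases Fin.eq_castSucc_or_eq_last i with ⟨j, rfl⟩ | rfl
  · rw [emb_add_single_castSucc, Finsupp.coe_equivFunOnFinite_symm]
  · rw [emb_add_single_last]

/-- `x'^β y^n / y^r = x'^β y^{n-r}` (truncated). -/
theorem emb_add_single_sub (β : Fin m →₀ ℕ) (n r : ℕ) :
    Finsupp.embDomain (Fin.succAboveEmb (Fin.last m)) β + Finsupp.single (Fin.last m) n -
        Finsupp.single (Fin.last m) r =
      Finsupp.embDomain (Fin.succAboveEmb (Fin.last m)) β + Finsupp.single (Fin.last m) (n - r) := by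
  ext i
  rw [Finsupp.tsub_apply]
  rcases Fin.eq_castSucc_or_eq_last i with ⟨j, rfl⟩ | rfl
  · rw [emb_add_single_castSucc, emb_add_single_castSucc, Finsupp.single_eq_of_ne (Fin.castSucc_lt_last j).ne,
      Nat.sub_zero]
  · rw [emb_add_single_last, emb_add_single_last, Finsupp.single_eq_same]

/-- Coefficients of `g · y^r` at `x'^β y^n`: `coeff (x'^β y^{n-r}) g` if `r ≤ n`, else `0`. -/
theorem coeff_emb_add_single_mul_X_pow (g : MvPowerSeries (Fin (m + 1)) k) (β : Fin m →₀ ℕ) (n r : ℕ) :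
    coeff (Finsupp.embDomain (Fin.succAboveEmb (Fin.last m)) β + Finsupp.single (Fin.last m) n)
        (g * X (Fin.last m) ^ r) =
      if r ≤ n then
        coeff (Finsupp.embDomain (Fin.succAboveEmb (Fin.last m)) β + Finsupp.single (Fin.last m) (n - r)) g
      else 0 := by
  classical
  rw [X_pow_eq, coeff_mul_monomial, mul_one, emb_add_single_sub]
  have hiff : Finsupp.single (Fin.last m) r ≤
      Finsupp.embDomain (Fin.succAboveEmb (Fin.last m)) β + Finsupp.single (Fin.last m) n ↔ r ≤ n := by
    rw [Finsupp.single_le_iff, emb_add_single_last]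
  by_cases h : r ≤ n
  · rw [if_pos (hiff.mpr h), if_pos h]
  · rw [if_neg (fun h' => h (hiff.mp h')), if_neg h]

/-- `x'^β y^a · y^b = x'^β y^{a+b}`. -/
theorem emb_add_single_add_single (β : Fin m →₀ ℕ) (a b : ℕ) :
    Finsupp.embDomain (Fin.succAboveEmb (Fin.last m)) β + Finsupp.single (Fin.last m) a +
        Finsupp.single (Fin.last m) b =
      Finsupp.embDomain (Fin.succAboveEmb (Fin.last m)) β + Finsupp.single (Fin.last m) (a + b) := by
  rw [add_assoc, ← Finsupp.single_add]

/-- The degree of `x'^β y^n`. -/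
theorem degree_emb_add_single (β : Fin m →₀ ℕ) (n : ℕ) :
    (Finsupp.embDomain (Fin.succAboveEmb (Fin.last m)) β + Finsupp.single (Fin.last m) n).degree = β.degree + n := by
  rw [map_add, Finsupp.degree_single, Finsupp.embDomain_eq_mapDomain, Finsupp.degree_mapDomain]

/-- Coefficients of a renamed series `g(x')` at `x'^β y^r`: `coeff β g` if `r = 0`, else `0`. -/
theorem coeff_emb_add_single_rename (β : Fin m →₀ ℕ) (r : ℕ) (g : MvPowerSeries (Fin m) k) :
    coeff (Finsupp.embDomain (Fin.succAboveEmb (Fin.last m)) β + Finsupp.single (Fin.last m) r)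
        (rename (Fin.succAboveEmb (Fin.last m)) g) = if r = 0 then coeff β g else 0 := by
  split_ifs with hr
  · rw [hr, Finsupp.single_zero, add_zero, coeff_embDomain_rename]
  · apply coeff_rename_eq_zero
    rintro ⟨γ, hγ⟩
    have h := DFunLike.congr_fun hγ (Fin.last m)
    rw [emb_add_single_last, Finsupp.mapDomain_notin_range _ _ (by simp)] at h
    exact hr h.symm

end TschirnhausForm

/-- HASSE SLICE OF A SHEAR (registered sub-goal `stub_tschirnhausHasseSlice` of `stub_tschirnhausForm`, over any
field).  In `k[[x', y]]` (`y = X (Fin.last m)`), let `φ` be `y`-free with `φ(0) = 0`, `τ = (x', y + φ)` the shear,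
`ρ = (x', φ)` the restriction to the graph, and `P = ∂_y^{(q)} F` the `q`-th Hasse derivative of `F`
(`coeff E P = C(E_y + q, q) · coeff (E + q e_y) F`).  Then the `y^q`-slice of `F ∘ τ` is `P ∘ ρ`:
`coeff (β + q e_y) (F ∘ τ) = coeff β (P ∘ ρ)` for every `y`-free exponent `β`.  (With `q = e + 1` and
`P(x', φ) = 0` this is the vanishing of the `y^{e+1}`-slice in the Tschirnhaus form.) -/
theorem stub_tschirnhausHasseSlice : ∀ (k : Type) [Field k] (m q : ℕ) (φ F P : MvPowerSeries (Fin (m + 1)) k)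
    (τ ρ : Fin (m + 1) → MvPowerSeries (Fin (m + 1)) k),
    (∀ E : Fin (m + 1) →₀ ℕ, E (Fin.last m) ≠ 0 → MvPowerSeries.coeff E φ = 0) →
    MvPowerSeries.constantCoeff φ = 0 →
    (∀ i, τ i = if i = Fin.last m then MvPowerSeries.X (Fin.last m) + φ else MvPowerSeries.X i) →
    (∀ i, ρ i = if i = Fin.last m then φ else MvPowerSeries.X i) →
    (∀ E : Fin (m + 1) →₀ ℕ, MvPowerSeries.coeff E P =
      ((E (Fin.last m) + q).choose q : k) * MvPowerSeries.coeff (E + Finsupp.single (Fin.last m) q) F) →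
    ∀ β : Fin (m + 1) →₀ ℕ, β (Fin.last m) = 0 →
      MvPowerSeries.coeff (β + Finsupp.single (Fin.last m) q) (MvPowerSeries.subst τ F) =
        MvPowerSeries.coeff β (MvPowerSeries.subst ρ P) := by
  intro k _ m q φ F P τ ρ hφ hφ0 hτ hρ hP β hβ
  exact TschirnhausForm.coeff_shear_slice hφ hφ0 hτ hρ q hP hβ

end Summit.ResolutionOfSingularities.ResolutionOfSingularities.Theorems
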